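import Literature.AlgebraicGeometry.Motives.HodgeLieSymplecticBlocksRankFour
import Literature.AlgebraicGeometry.Motives.SymplecticRankFourIdeals
import Literature.AlgebraicGeometry.Motives.HodgeThetaAnnihilatorTimesRigidSymplectic
import Literature.AlgebraicGeometry.Motives.HodgeLieDerivedSemisimple
import Mathlib.Algebra.Lie.CartanCriterion
import Mathlib.Algebra.Lie.Killing
import Mathlib.Algebra.Lie.Semisimple.Basic
import HarnessLib

/-!
# Four-dimensional real eigenblocks: block data, ideals of `Lie Hg ⊗ ℂ` on a block, and SEMISIMPLICITY of `Lie Hg ⊗ ℂ`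
# (the inputs of the Goursat step for real multiplication of relative dimension two)

Family `hodge`, layer `Literature/AlgebraicGeometry/Motives` (abstract polarizable `ℚ`-Hodge structures; no geometry); THEOREMS ONLY (no
definition, no named fact; D-0026).  Research context: cell `pub-hodgecm2` (COR-CM), seat `b27`, count-neutral lane MT-RANK ladder, rung
`t = 10e + 1` (real multiplication of relative dimension two).  UNCONDITIONAL; nothing here uses or asserts HC_CM.  Sequel of
`HodgeLieSymplecticBlocksRankFour` (S1: on every block `T_i`, `Lie Hg ⊗ ℂ` restricts ONTO `𝔰𝔭(T_i)`) and `SymplecticRankFourIdeals` (S2: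
`𝔰𝔭₄` is simple and centre-free in the Siegel form); the Goursat step itself is the sequel `HodgeLieSymplecticBlocksProduct`.

SETTING as in S1: `H` effective polarized of weight `1`, `End_Hdg` self-adjoint for `ψ`, `σ_i` REAL characters with FOUR-dimensional blocks
`T_i = H.eigenBlock (σ i)` forming an internal direct sum `V_ℂ = ⊕_i T_i`; `𝔤 = Lie Hg(H) ⊗ ℂ`.

* `SymplecticBlocks.exists_blockData` — on each block: the restricted form `ω_i = ψ_ℂ|_{T_i}` is non-degenerate and alternating, and
  `Θ|_{T_i}` is an `ω_i`-skew involution with eigen-PLANES `T_i ∩ V^{1,0}`, `T_i ∩ V^{0,1}` (S1 §1–§2 repackaged).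
* **`SymplecticBlocks.restrict_ideal_dichotomy`** — an ideal `N ⊆ 𝔤` either KILLS the block `T_j` or restricts ONTO `𝔰𝔭(T_j)` (its
  restrictions form an ideal of `𝔰𝔭(T_j) = c_j(𝔤)`, and `𝔰𝔭₄` is simple).
* **`SymplecticBlocks.apply_eq_zero_of_forall_commute`** — an element of `𝔤` commuting on `T_j` with a subspace of `𝔤` that restricts onto
  `𝔰𝔭(T_j)` kills `T_j` (`𝔰𝔭₄` has trivial centre).
* **`SymplecticBlocks.isSemisimple_of_eq_hodgeLieC`** — every Lie subalgebra `𝔏 ≤ 𝔤𝔩(V_ℂ)` with carrier `𝔤` is SEMISIMPLE (Mathlib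
  `LieAlgebra.IsSemisimple ℂ`): its radical is central (the tree's `hasCentralRadical_of_eq_hodgeLieC`, Deligne I 3.6 «`Hg` is reductive»), and
  its centre vanishes block by block; Cartan's criterion (Mathlib `HasTrivialRadical.instIsKilling`, `IsKilling.instSemisimple`).  This is
  Moonen–Zarhin's «if `X` has no factors of type IV then `Hg(X)` is semisimple» over `ℂ`, in the form needed to split ideals.

## References

* [MoonenZarhin1999LowDim] B. Moonen, Yu. G. Zarhin, Math. Ann. 315 (1999), §1 («`Hg` semisimple without type IV»), §3 (3.1), Lemma (3.4).
  [cite: MoonenZarhin1999LowDim, §3 (3.1) and Lemma (3.4)]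
* [Deligne1982HodgeCycles] P. Deligne, LNM 900 (1982), I §3 Prop. 3.6 («`Hg` is reductive»). [cite: Deligne1982HodgeCycles, I §3 Prop. 3.6]
* [Humphreys1972] J. E. Humphreys, GTM 9, §5.1–§5.2 (Cartan's criterion; semisimple = direct sum of simple ideals). [cite: Humphreys1972, §5.2]
* [Hazama1983] F. Hazama, Tôhoku Math. J. 35 (1983), §3 pp. 305–306 (the blocks and their symplectic forms). [cite: Hazama1983, §3 (pp. 305–306)]
-/

noncomputable section

open scoped TensorProduct

namespace Literature.AlgebraicGeometry.Motives

namespace HodgeStructure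

universe u

variable {V : Type u} [AddCommGroup V] [Module ℚ V] [Module.Finite ℚ V] [HodgeTensorFacts.{u, u}] {n : ℤ}
variable {ι : Type*} [DecidableEq ι]

/-! ### §1 Block data and the two consequences of «`𝔰𝔭₄` is simple» on a block -/

/-- **Block data.**  On each block `T = T_i`: the restricted form `ω = ψ_ℂ|_T` is non-degenerate and alternating, and the restriction `Θ|_T`
of a Hodge operator is an `ω`-skew involution whose eigenspaces `T ∩ V^{1,0}`, `T ∩ V^{0,1}` are planes (S1 §1–§2, repackaged).
[cite: Hazama1983, §3 (pp. 305–306)] [cite: MoonenZarhin1999LowDim, §3 (3.1) and Lemma (3.4)] -/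
theorem SymplecticBlocks.exists_blockData (H : HodgeStructure V n) (hn : n = 1) (heff : H.IsEffective) (ψ : H.Polarization)
    (hself : ∀ a : H.endAlg, LinearMap.IsAdjointPair ψ.form ψ.form (a : Module.End ℚ V) (a : Module.End ℚ V))
    (σ : ι → (H.endAlg →+* ℂ)) (hreal : ∀ i, (starRingEnd ℂ).comp (σ i) = σ i)
    (hint : DirectSum.IsInternal fun i => H.eigenBlock (σ i)) (h4 : ∀ i, Module.finrank ℂ (H.eigenBlock (σ i)) = 4)
    {Θ : Module.End ℂ (ℂ ⊗[ℚ] V)} (hΘ : ∀ p, ∀ x ∈ H.piece p (n - p), Θ x = ((2 * p - n : ℤ) : ℂ) • x) (i : ι) :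
    ((ψ.form.baseChange ℂ).compl₁₂ (H.eigenBlock (σ i)).subtype (H.eigenBlock (σ i)).subtype).Nondegenerate ∧
    (∀ x y : H.eigenBlock (σ i), (ψ.form.baseChange ℂ).compl₁₂ (H.eigenBlock (σ i)).subtype (H.eigenBlock (σ i)).subtype x y =
      -(ψ.form.baseChange ℂ).compl₁₂ (H.eigenBlock (σ i)).subtype (H.eigenBlock (σ i)).subtype y x) ∧
    ∃ (TΘ : Module.End ℂ ↥(H.eigenBlock (σ i))) (P Q : Submodule ℂ ↥(H.eigenBlock (σ i))),
      (∀ x : H.eigenBlock (σ i), ((TΘ x : H.eigenBlock (σ i)) : ℂ ⊗[ℚ] V) = Θ x) ∧ (∀ v, TΘ (TΘ v) = v) ∧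
      (∀ x y : H.eigenBlock (σ i), (ψ.form.baseChange ℂ).compl₁₂ (H.eigenBlock (σ i)).subtype (H.eigenBlock (σ i)).subtype (TΘ x) y +
        (ψ.form.baseChange ℂ).compl₁₂ (H.eigenBlock (σ i)).subtype (H.eigenBlock (σ i)).subtype x (TΘ y) = 0) ∧
      (∀ x ∈ P, TΘ x = x) ∧ (∀ x ∈ Q, TΘ x = -x) ∧ (∀ v, (2 : ℂ)⁻¹ • (v + TΘ v) ∈ P) ∧ (∀ v, (2 : ℂ)⁻¹ • (v - TΘ v) ∈ Q) ∧
      Module.finrank ℂ P = 2 ∧ Module.finrank ℂ Q = 2 := by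
  subst hn
  set T := H.eigenBlock (σ i) with hT
  have hΘC : Θ ∈ H.hodgeLieC := H.mem_hodgeLieC_of_forall_piece hΘ
  obtain ⟨hPv, hQv, hΘ10, hΘ01, hΘΘ⟩ := UnitaryTheta.theta_facts H rfl heff hΘ
  have hYT : ∀ Y ∈ H.hodgeLieC, ∀ x ∈ T, Y x ∈ T := fun Y hY x hx => H.apply_mem_eigenBlock_of_mem_hodgeLieC hY hx
  set ω : LinearMap.BilinForm ℂ ↥T := (ψ.form.baseChange ℂ).compl₁₂ T.subtype T.subtype with hω
  have hω_apply : ∀ x y : T, ω x y = ψ.form.baseChange ℂ (x : ℂ ⊗[ℚ] V) y := fun x y => rfl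
  have hsepL : ∀ x : T, (∀ y : T, ω x y = 0) → x = 0 := by
    intro x hx
    exact Subtype.ext (SymplecticBlocks.eq_zero_of_forall_block H ψ hself σ hint i x.2 fun y hy => by
      have h := hx ⟨y, hy⟩
      rwa [hω_apply] at h)
  have hωalt : ∀ x y : T, ω x y = -ω y x := fun x y => by
    rw [hω_apply, hω_apply, form_baseChange_swap_of_odd H odd_one ψ]
  refine ⟨⟨fun x hx => hsepL x hx, fun y hy => hsepL y fun x => by rw [hωalt, hy x, neg_zero]⟩, hωalt, ?_⟩
  set TΘ : Module.End ℂ ↥T := Θ.restrict fun x hx => hYT Θ hΘC x hx with hTΘ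
  have hTΘ_coe : ∀ x : T, ((TΘ x : T) : ℂ ⊗[ℚ] V) = Θ x := fun x => rfl
  refine ⟨TΘ, (H.piece 1 0).comap T.subtype, (H.piece 0 1).comap T.subtype, hTΘ_coe,
    fun v => Subtype.ext (by rw [hTΘ_coe, hTΘ_coe, hΘΘ]), fun x y => ?_,
    fun x hx => Subtype.ext (by rw [hTΘ_coe]; exact hΘ10 _ hx),
    fun x hx => Subtype.ext (by rw [hTΘ_coe, Submodule.coe_neg]; exact hΘ01 _ hx), fun v => ?_, fun v => ?_, ?_, ?_⟩
  · rw [hω_apply, hω_apply, hTΘ_coe, hTΘ_coe, formBaseChange_skew_of_mem_hodgeLieC ψ hΘC, neg_add_cancel]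
  · change (((2 : ℂ)⁻¹ • (v + TΘ v) : T) : ℂ ⊗[ℚ] V) ∈ H.piece 1 0
    rw [Submodule.coe_smul, Submodule.coe_add, hTΘ_coe]
    exact hPv _
  · change (((2 : ℂ)⁻¹ • (v - TΘ v) : T) : ℂ ⊗[ℚ] V) ∈ H.piece 0 1
    rw [Submodule.coe_smul, Submodule.coe_sub, hTΘ_coe]
    exact hQv _
  · have hTconj : ∀ x ∈ T, conj x ∈ T := fun x hx => SymplecticBlocks.conj_mem_eigenBlock_of_real H (hreal i) hx
    obtain ⟨hP2', -⟩ := SymplecticBlocks.finrank_inf_piece_eq_two H rfl heff hΘ hTconj (hYT Θ hΘC) (h4 i)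
    have hPeq : (H.piece 1 0).comap T.subtype = (T ⊓ H.piece 1 0).comap T.subtype := by
      ext x
      simp only [Submodule.mem_comap, Submodule.coe_subtype, Submodule.mem_inf, SetLike.coe_mem, true_and]
    rw [hPeq, (Submodule.comapSubtypeEquivOfLe (inf_le_left : T ⊓ H.piece 1 0 ≤ T)).finrank_eq, hP2']
  · have hTconj : ∀ x ∈ T, conj x ∈ T := fun x hx => SymplecticBlocks.conj_mem_eigenBlock_of_real H (hreal i) hx
    obtain ⟨-, hQ2'⟩ := SymplecticBlocks.finrank_inf_piece_eq_two H rfl heff hΘ hTconj (hYT Θ hΘC) (h4 i)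
    have hQeq : (H.piece 0 1).comap T.subtype = (T ⊓ H.piece 0 1).comap T.subtype := by
      ext x
      simp only [Submodule.mem_comap, Submodule.coe_subtype, Submodule.mem_inf, SetLike.coe_mem, true_and]
    rw [hQeq, (Submodule.comapSubtypeEquivOfLe (inf_le_left : T ⊓ H.piece 0 1 ≤ T)).finrank_eq, hQ2']

/-- **An ideal of `𝔤 = Lie Hg ⊗ ℂ` either kills the block `T_j` or restricts ONTO `𝔰𝔭(T_j)`**: its restrictions form an ideal of
`𝔰𝔭(T_j) = c_j(𝔤)` (S1), and «`𝔰𝔭₄` is simple» (`SymplecticIdeal.mem_of_ne_bot`). [cite: MoonenZarhin1999LowDim, §3 (3.1) and Lemma (3.4)]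
[cite: Humphreys1972, §5.2] -/
theorem SymplecticBlocks.restrict_ideal_dichotomy (H : HodgeStructure V n) (hn : n = 1) (heff : H.IsEffective) (ψ : H.Polarization)
    (hself : ∀ a : H.endAlg, LinearMap.IsAdjointPair ψ.form ψ.form (a : Module.End ℚ V) (a : Module.End ℚ V))
    (σ : ι → (H.endAlg →+* ℂ)) (hreal : ∀ i, (starRingEnd ℂ).comp (σ i) = σ i)
    (hint : DirectSum.IsInternal fun i => H.eigenBlock (σ i)) (h4 : ∀ i, Module.finrank ℂ (H.eigenBlock (σ i)) = 4)
    (N : Submodule ℂ (Module.End ℂ (ℂ ⊗[ℚ] V))) (hN : N ≤ H.hodgeLieC)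
    (hNideal : ∀ W ∈ H.hodgeLieC, ∀ Y ∈ N, W * Y - Y * W ∈ N) (j : ι) :
    (∀ Y ∈ N, ∀ x ∈ H.eigenBlock (σ j), Y x = 0) ∨
      ∀ g : Module.End ℂ ↥(H.eigenBlock (σ j)),
        (∀ x y : H.eigenBlock (σ j), ψ.form.baseChange ℂ ((g x : H.eigenBlock (σ j)) : ℂ ⊗[ℚ] V) y +
          ψ.form.baseChange ℂ (x : ℂ ⊗[ℚ] V) ((g y : H.eigenBlock (σ j)) : ℂ ⊗[ℚ] V) = 0) →
        ∃ Y ∈ N, ∀ x : H.eigenBlock (σ j), ((g x : H.eigenBlock (σ j)) : ℂ ⊗[ℚ] V) = Y x := by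
  classical
  obtain ⟨Θ, hΘ⟩ := exists_hodgeTheta H
  obtain ⟨hωnd, hωalt, TΘ, P, Q, hTΘ, hTT, hTskew, hP, hQ, hPmem, hQmem, hP2, hQ2⟩ :=
    SymplecticBlocks.exists_blockData H hn heff ψ hself σ hreal hint h4 hΘ j
  set T := H.eigenBlock (σ j) with hT
  set ω : LinearMap.BilinForm ℂ ↥T := (ψ.form.baseChange ℂ).compl₁₂ T.subtype T.subtype with hω
  have hω_apply : ∀ x y : T, ω x y = ψ.form.baseChange ℂ (x : ℂ ⊗[ℚ] V) y := fun x y => rfl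
  have hYT : ∀ Y ∈ H.hodgeLieC, ∀ x ∈ T, Y x ∈ T := fun Y hY x hx => H.apply_mem_eigenBlock_of_mem_hodgeLieC hY hx
  -- the restrictions of `N`
  let I : Submodule ℂ (Module.End ℂ ↥T) :=
    { carrier := {g | ∃ Y ∈ N, ∀ x : T, ((g x : T) : ℂ ⊗[ℚ] V) = Y x}
      zero_mem' := ⟨0, N.zero_mem, fun x => by simp⟩
      add_mem' := by
        rintro g₁ g₂ ⟨Y₁, hY₁, h₁⟩ ⟨Y₂, hY₂, h₂⟩
        exact ⟨Y₁ + Y₂, N.add_mem hY₁ hY₂, fun x => by rw [LinearMap.add_apply, Submodule.coe_add, h₁, h₂, LinearMap.add_apply]⟩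
      smul_mem' := by
        rintro c g ⟨Y, hY, h⟩
        exact ⟨c • Y, N.smul_mem c hY, fun x => by rw [LinearMap.smul_apply, Submodule.coe_smul, h, LinearMap.smul_apply]⟩ }
  have hmemI : ∀ g, g ∈ I ↔ ∃ Y ∈ N, ∀ x : T, ((g x : T) : ℂ ⊗[ℚ] V) = Y x := fun g => Iff.rfl
  have hIskew : ∀ g ∈ I, ∀ x y : T, ω (g x) y + ω x (g y) = 0 := by
    rintro g ⟨Y, hY, h⟩ x y
    rw [hω_apply, hω_apply, h, h, formBaseChange_skew_of_mem_hodgeLieC ψ (hN hY), neg_add_cancel]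
  -- `I` is an ideal of `𝔰𝔭(T)`: every skew `Z` on `T` is a restriction of some `W ∈ 𝔤` (S1)
  have hI : ∀ Z : Module.End ℂ ↥T, (∀ x y : T, ω (Z x) y + ω x (Z y) = 0) → ∀ g ∈ I, Z * g - g * Z ∈ I := by
    rintro Z hZ g ⟨Y, hY, h⟩
    obtain ⟨W, hW, hWZ⟩ := SymplecticBlocks.exists_mem_hodgeLieC_restrict_eq H hn heff ψ hself σ hreal hint h4 j Z
      (fun x y => by rw [← hω_apply, ← hω_apply]; exact hZ x y)
    refine (hmemI _).2 ⟨W * Y - Y * W, hNideal W hW Y hY, fun x => ?_⟩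
    rw [LinearMap.sub_apply, Submodule.coe_sub, Module.End.mul_apply, Module.End.mul_apply, hWZ, h, h, hWZ, LinearMap.sub_apply,
      Module.End.mul_apply, Module.End.mul_apply]
  by_cases hI0 : I = ⊥
  · left
    intro Y hY x hx
    have hg : Y.restrict (fun x hx => hYT Y (hN hY) x hx) ∈ I := (hmemI _).2 ⟨Y, hY, fun x => rfl⟩
    rw [hI0, Submodule.mem_bot] at hg
    have h := congrArg (fun g : Module.End ℂ ↥T => ((g ⟨x, hx⟩ : T) : ℂ ⊗[ℚ] V)) hg
    simpa using h
  · right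
    intro g hg
    have hgI : g ∈ I := SymplecticIdeal.mem_of_ne_bot ω hωnd hωalt hTT hTskew hP hQ hPmem hQmem hP2 hQ2 I hIskew hI hI0
      (fun x y => by rw [hω_apply, hω_apply]; exact hg x y)
    exact (hmemI g).1 hgI

/-- **An element of `𝔤` whose restriction to `T_j` commutes with the restrictions of a subspace `N ⊆ 𝔤` that restricts ONTO `𝔰𝔭(T_j)`
kills `T_j`** («`𝔰𝔭₄` has trivial centre», `SymplecticIdeal.eq_zero_of_forall_bracket_eq_zero`). [cite: MoonenZarhin1999LowDim, §3 (3.1) and Lemma (3.4)]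
[cite: Humphreys1972, §5.2] -/
theorem SymplecticBlocks.apply_eq_zero_of_forall_commute (H : HodgeStructure V n) (hn : n = 1) (heff : H.IsEffective)
    (ψ : H.Polarization)
    (hself : ∀ a : H.endAlg, LinearMap.IsAdjointPair ψ.form ψ.form (a : Module.End ℚ V) (a : Module.End ℚ V))
    (σ : ι → (H.endAlg →+* ℂ)) (hreal : ∀ i, (starRingEnd ℂ).comp (σ i) = σ i)
    (hint : DirectSum.IsInternal fun i => H.eigenBlock (σ i)) (h4 : ∀ i, Module.finrank ℂ (H.eigenBlock (σ i)) = 4) (j : ι)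
    (N : Submodule ℂ (Module.End ℂ (ℂ ⊗[ℚ] V)))
    (hNonto : ∀ g : Module.End ℂ ↥(H.eigenBlock (σ j)),
        (∀ x y : H.eigenBlock (σ j), ψ.form.baseChange ℂ ((g x : H.eigenBlock (σ j)) : ℂ ⊗[ℚ] V) y +
          ψ.form.baseChange ℂ (x : ℂ ⊗[ℚ] V) ((g y : H.eigenBlock (σ j)) : ℂ ⊗[ℚ] V) = 0) →
        ∃ Y ∈ N, ∀ x : H.eigenBlock (σ j), ((g x : H.eigenBlock (σ j)) : ℂ ⊗[ℚ] V) = Y x)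
    {Z : Module.End ℂ (ℂ ⊗[ℚ] V)} (hZ : Z ∈ H.hodgeLieC) (hcomm : ∀ Y ∈ N, ∀ x ∈ H.eigenBlock (σ j), (Y * Z - Z * Y) x = 0)
    {x : ℂ ⊗[ℚ] V} (hx : x ∈ H.eigenBlock (σ j)) : Z x = 0 := by
  classical
  obtain ⟨Θ, hΘ⟩ := exists_hodgeTheta H
  obtain ⟨hωnd, hωalt, TΘ, P, Q, hTΘ, hTT, hTskew, hP, hQ, hPmem, hQmem, hP2, hQ2⟩ :=
    SymplecticBlocks.exists_blockData H hn heff ψ hself σ hreal hint h4 hΘ j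
  set T := H.eigenBlock (σ j) with hT
  set ω : LinearMap.BilinForm ℂ ↥T := (ψ.form.baseChange ℂ).compl₁₂ T.subtype T.subtype with hω
  have hω_apply : ∀ x y : T, ω x y = ψ.form.baseChange ℂ (x : ℂ ⊗[ℚ] V) y := fun x y => rfl
  have hYT : ∀ Y ∈ H.hodgeLieC, ∀ x ∈ T, Y x ∈ T := fun Y hY x hx => H.apply_mem_eigenBlock_of_mem_hodgeLieC hY hx
  set ZT : Module.End ℂ ↥T := Z.restrict fun x hx => hYT Z hZ x hx with hZT
  have hZT_coe : ∀ x : T, ((ZT x : T) : ℂ ⊗[ℚ] V) = Z x := fun x => rfl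
  have hZTskew : ∀ x y : T, ω (ZT x) y + ω x (ZT y) = 0 := fun x y => by
    rw [hω_apply, hω_apply, hZT_coe, hZT_coe, formBaseChange_skew_of_mem_hodgeLieC ψ hZ, neg_add_cancel]
  have h0 : ZT = 0 := by
    refine SymplecticIdeal.eq_zero_of_forall_bracket_eq_zero ω hωnd hωalt hTT hTskew hP hQ hPmem hQmem hP2 hQ2 hZTskew fun W hW => ?_
    obtain ⟨Y, hY, hYW⟩ := hNonto W fun x y => by rw [← hω_apply, ← hω_apply]; exact hW x y
    refine LinearMap.ext fun y => Subtype.ext ?_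
    rw [LinearMap.sub_apply, Submodule.coe_sub, Module.End.mul_apply, Module.End.mul_apply, hYW, hZT_coe, hZT_coe, hYW,
      LinearMap.zero_apply, Submodule.coe_zero]
    have h := hcomm Y hY y y.2
    rwa [LinearMap.sub_apply, Module.End.mul_apply, Module.End.mul_apply] at h
  have h := hZT_coe ⟨x, hx⟩
  rw [h0, LinearMap.zero_apply, Submodule.coe_zero] at h
  exact h.symm

/-! ### §2 `Lie Hg ⊗ ℂ` is semisimple -/

/-- **`𝔏` (carrier `Lie Hg ⊗ ℂ`) is a semisimple Lie algebra** in the four-dimensional real-block situation: its radical is its centre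
(`hasCentralRadical_of_eq_hodgeLieC`, Deligne I 3.6), a central element restricts on each block to an element commuting with `𝔰𝔭(T_j)`,
hence kills every block (§1), hence vanishes (`V_ℂ = ⊕ T_j`); Cartan's criterion (Mathlib) then gives semisimplicity.
[cite: Deligne1982HodgeCycles, I §3 Prop. 3.6] [cite: Humphreys1972, §5.2] -/
theorem SymplecticBlocks.isSemisimple_of_eq_hodgeLieC (H : HodgeStructure V n) (hn : n = 1) (heff : H.IsEffective)
    (ψ : H.Polarization)
    (hself : ∀ a : H.endAlg, LinearMap.IsAdjointPair ψ.form ψ.form (a : Module.End ℚ V) (a : Module.End ℚ V))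
    (σ : ι → (H.endAlg →+* ℂ)) (hreal : ∀ i, (starRingEnd ℂ).comp (σ i) = σ i)
    (hint : DirectSum.IsInternal fun i => H.eigenBlock (σ i)) (h4 : ∀ i, Module.finrank ℂ (H.eigenBlock (σ i)) = 4) :
    letI : LieRing (Module.End ℂ (ℂ ⊗[ℚ] V)) := LieRing.ofAssociativeRing
    ∀ (𝔏 : LieSubalgebra ℂ (Module.End ℂ (ℂ ⊗[ℚ] V))), 𝔏.toSubmodule = H.hodgeLieC → LieAlgebra.IsSemisimple ℂ 𝔏 := by
  letI : LieRing (Module.End ℂ (ℂ ⊗[ℚ] V)) := LieRing.ofAssociativeRing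
  intro 𝔏 h𝔏
  haveI := hasCentralRadical_of_eq_hodgeLieC H ψ 𝔏 h𝔏
  haveI : Module.Finite ℂ 𝔏 := Module.Finite.of_injective 𝔏.toSubmodule.subtype Subtype.val_injective
  have hmem : ∀ Y : Module.End ℂ (ℂ ⊗[ℚ] V), Y ∈ H.hodgeLieC ↔ Y ∈ 𝔏 := fun Y => by
    rw [← LieSubalgebra.mem_toSubmodule, h𝔏]
  -- the centre vanishes
  have hcenter : LieAlgebra.center ℂ 𝔏 = ⊥ := by
    rw [eq_bot_iff]
    intro Z hZ
    rw [LieSubmodule.mem_bot]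
    have hZc : ∀ Y ∈ H.hodgeLieC, Y * (Z : Module.End ℂ (ℂ ⊗[ℚ] V)) - (Z : Module.End ℂ (ℂ ⊗[ℚ] V)) * Y = 0 := by
      intro Y hY
      have h := (LieModule.mem_maxTrivSubmodule ℂ 𝔏 𝔏 Z).1 hZ ⟨Y, (hmem Y).1 hY⟩
      have h' := congrArg Subtype.val h
      rwa [LieSubalgebra.coe_bracket, LieRing.of_associative_ring_bracket] at h'
    have hZ0 : (Z : Module.End ℂ (ℂ ⊗[ℚ] V)) = 0 := by
      refine LinearMap.ext fun v => ?_
      have hv : v ∈ ⨆ j, H.eigenBlock (σ j) := by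
        rw [hint.submodule_iSup_eq_top]
        exact Submodule.mem_top
      rw [LinearMap.zero_apply]
      induction hv using Submodule.iSup_induction' with
      | mem j x hx =>
        exact SymplecticBlocks.apply_eq_zero_of_forall_commute H hn heff ψ hself σ hreal hint h4 j H.hodgeLieC
          (SymplecticBlocks.exists_mem_hodgeLieC_restrict_eq H hn heff ψ hself σ hreal hint h4 j) ((hmem _).2 Z.2)
          (fun Y hY y _ => by rw [hZc Y hY, LinearMap.zero_apply]) hx
      | zero => simp
      | add x y _ _ hx hy => rw [map_add, hx, hy, add_zero]
    exact Subtype.ext hZ0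
  haveI : LieAlgebra.HasTrivialRadical ℂ 𝔏 := ⟨by rw [LieAlgebra.HasCentralRadical.radical_eq_center, hcenter]⟩
  exact LieAlgebra.IsKilling.instSemisimple ℂ 𝔏

end HodgeStructure

end Literature.AlgebraicGeometry.Motives

end
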